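import Literature.AlgebraicGeometry.Resolution.AffineBlowupAlgebra
import HarnessLib

/-!
# Derivations of the affine blowup algebra `R[I/a]`: values on the generators, and plain extensions

Topic: `Literature/AlgebraicGeometry/Resolution`. Complements `AffineBlowupAlgebra.lean`, which
extends `a · δ` (for any `k`-derivation `δ` of `R`) to a derivation `D` of the affine blowup
algebra `R[I/a] ⊆ R[1/a]` with `D(r) = a · δ(r)` (`exists_derivation_blowupAlgebra`). For the
chart computations of de Jong 1996, 4.27 (the blow-up of `k⟦u, v, t⟧/(uv - t₁ ⋯ t_s)` in
`(u, v, t₁, t₂)`: "Chart "`t₁ ≠ 0`" … `u = t₁u'`, `v = t₁v'`, `t₂ = t₁t₂'` and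
`u'v' - t₂' t₃ ⋯ t_s = 0`", p. 76) one needs the VALUES of these derivations on the generators
`x/a` and, at the points of the exceptional divisor, also the PLAIN extensions of the derivations
`∂/∂t_c` (which kill `a = t₁` and preserve the centre), without the factor `a`. Both are PROVED
here, for any commutative ring `R`, ideal `I` and element `a`:

* `blowupAlgebra.gen I a x hx` — the generator `x/a ∈ R[I/a]` (`x ∈ I`), with
  `gen_mul_algebraMap : (x/a) · a = x`;
* `Derivation.blowupAlgebra_apply_gen` — for a derivation `D` of `R[I/a]` with `D(r) = a δ(r)`
  on `R`: `D(x/a) = δ(x) − (x/a) δ(a)` (`a` is a non-zero-divisor of `R[I/a]`,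
  `algebraMap_mem_nonZeroDivisors_blowupAlgebra`);
* `exists_derivation_blowupAlgebra_of_apply_eq_zero` — **plain extension**: if `δ(a) = 0` and
  `δ(I) ⊆ I`, the extension `δ̃` of `δ` to `R[1/a]` (`exists_derivation_extend_of_isLocalization`)
  preserves `R[I/a]`, since `δ̃(x/a) = δ(x)/a` with `δ(x) ∈ I`; its restriction `D` has
  `D(r) = δ(r)` and `D(x/a) = δ(x)/a`.

All statements are [folklore] (the derivation `δ̃(y/a) = (δ(y) a − y δ(a))/a²` of a localization).

## Sources

* U. Görtz, T. Wedhorn, *Algebraic Geometry I*, 2nd ed. (2020), (13.19) p. 415 (the charts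
  `A[I/f] ⊆ A_f`). [GortzWedhorn2020]
* A. J. de Jong, *Smoothness, semi-stability and alterations*, Publ. Math. IHÉS 83 (1996), 4.27,
  p. 76 (the consumer). [DeJong1996]
-/

noncomputable section

open IsLocalization

namespace Literature.AlgebraicGeometry.Resolution

universe u v

variable {R : Type u} [CommRing R] (I : Ideal R) (a : R)

/-! ## The generators `x/a` of `R[I/a]` as elements of the subalgebra -/

/-- The generator `x/a ∈ R[I/a]`, for `x ∈ I`. [cite: GortzWedhorn2020, (13.19) p. 415] -/
def blowupAlgebra.gen (x : R) (hx : x ∈ I) : blowupAlgebra I a :=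
  ⟨algebraMap R (Localization.Away a) x * Away.invSelf a, div_mem_blowupAlgebra I a hx⟩

/-- The value of `x/a` in `R[1/a]`. [folklore] -/
@[simp]
theorem blowupAlgebra.coe_gen (x : R) (hx : x ∈ I) :
    (blowupAlgebra.gen I a x hx : Localization.Away a) =
      algebraMap R (Localization.Away a) x * Away.invSelf a :=
  rfl

/-- `(x/a) · a = x` in `R[I/a]`. [folklore] -/
theorem blowupAlgebra.gen_mul_algebraMap (x : R) (hx : x ∈ I) :
    blowupAlgebra.gen I a x hx * algebraMap R (blowupAlgebra I a) a =
      algebraMap R (blowupAlgebra I a) x :=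
  Subtype.ext (div_mul_algebraMap a x)

/-- `a · (x/a) = x` in `R[I/a]`. [folklore] -/
theorem blowupAlgebra.algebraMap_mul_gen (x : R) (hx : x ∈ I) :
    algebraMap R (blowupAlgebra I a) a * blowupAlgebra.gen I a x hx =
      algebraMap R (blowupAlgebra I a) x := by
  rw [mul_comm, blowupAlgebra.gen_mul_algebraMap]

/-- `a/a = 1`. [folklore] -/
theorem blowupAlgebra.gen_self (ha : a ∈ I) : blowupAlgebra.gen I a a ha = 1 :=
  Subtype.ext (Away.mul_invSelf a)

/-- Additivity of the generators: `(x + y)/a = x/a + y/a`. [folklore] -/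
theorem blowupAlgebra.gen_add (x y : R) (hx : x ∈ I) (hy : y ∈ I) :
    blowupAlgebra.gen I a (x + y) (I.add_mem hx hy) =
      blowupAlgebra.gen I a x hx + blowupAlgebra.gen I a y hy :=
  Subtype.ext (by simp [add_mul])

/-- `R`-linearity of the generators: `(r x)/a = r · (x/a)`. [folklore] -/
theorem blowupAlgebra.gen_mul_left (r x : R) (hx : x ∈ I) :
    blowupAlgebra.gen I a (r * x) (I.mul_mem_left r hx) =
      algebraMap R (blowupAlgebra I a) r * blowupAlgebra.gen I a x hx :=
  Subtype.ext (by simp [mul_assoc])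

/-- `R[I/a]` is generated over `R` by the `x/a`, `x ∈ I` (the definition, restated with `gen`).
[cite: GortzWedhorn2020, (13.19) p. 415] -/
theorem blowupAlgebra.adjoin_range_gen :
    Algebra.adjoin R (Set.range fun p : {x : R // x ∈ I} =>
      (blowupAlgebra.gen I a p.1 p.2 : Localization.Away a)) = blowupAlgebra I a := by
  unfold blowupAlgebra
  congr 1
  ext y
  simp only [Set.mem_range, Subtype.exists, blowupAlgebraGens, Set.mem_setOf_eq,
    blowupAlgebra.coe_gen]
  constructor
  · rintro ⟨x, hx, rfl⟩
    exact ⟨x, hx, rfl⟩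
  · rintro ⟨x, hx, rfl⟩
    exact ⟨x, hx, rfl⟩

/-! ## Values of the derivations `a · δ̃` on the generators -/

variable {I a}

/-- **`D(x/a) = δ(x) − (x/a) δ(a)`** for a derivation `D` of `R[I/a]` restricting `a · δ̃`, i.e.
with `D(r) = a δ(r)` on `R` (as provided by `exists_derivation_blowupAlgebra`): apply `D` to
`a · (x/a) = x` and cancel the non-zero-divisor `a`. [folklore] -/
theorem Derivation.blowupAlgebra_apply_gen {S₀ : Type*} [CommSemiring S₀] [Algebra S₀ (blowupAlgebra I a)]
    (D : Derivation S₀ (blowupAlgebra I a) (blowupAlgebra I a)) {δ : R → R}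
    (hD : ∀ r : R, D (algebraMap R (blowupAlgebra I a) r) =
      algebraMap R (blowupAlgebra I a) a * algebraMap R (blowupAlgebra I a) (δ r))
    (x : R) (hx : x ∈ I) :
    D (blowupAlgebra.gen I a x hx) = algebraMap R (blowupAlgebra I a) (δ x) -
      blowupAlgebra.gen I a x hx * algebraMap R (blowupAlgebra I a) (δ a) := by
  have h := congrArg D (blowupAlgebra.algebraMap_mul_gen I a x hx)
  rw [Derivation.leibniz, hD, hD, smul_eq_mul, smul_eq_mul] at h
  -- `a · D(x/a) = a · (δ x − (x/a) δ a)`; cancel `a`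
  have hreg := algebraMap_mem_nonZeroDivisors_blowupAlgebra (I := I) (a := a)
  refine (mul_cancel_left_mem_nonZeroDivisors hreg).mp ?_
  rw [mul_sub, ← h]
  ring

/-! ## Plain extensions of derivations killing `a` and preserving `I` -/

variable (k : Type v) [CommRing k] [Algebra k R]

/-- **Plain extension of a derivation to `R[I/a]`**: if the `k`-derivation `δ` of `R` kills `a`
and maps `I` into `I`, then its extension `δ̃` to `R[1/a]` restricts to a derivation `D` of
`R[I/a]` with `D(r) = δ(r)` for `r ∈ R` and `D(x/a) = δ(x)/a` for `x ∈ I`. (From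
`x = a · (x/a)` and `δ̃(a) = 0`: `δ(x) = a · δ̃(x/a)`.) [folklore] -/
theorem exists_derivation_blowupAlgebra_of_apply_eq_zero (δ : Derivation k R R) (ha : δ a = 0)
    (hI : ∀ x ∈ I, δ x ∈ I) :
    ∃ D : Derivation k (blowupAlgebra I a) (blowupAlgebra I a),
      (∀ r : R, D (algebraMap R (blowupAlgebra I a) r) = algebraMap R (blowupAlgebra I a) (δ r)) ∧
      ∀ (x : R) (hx : x ∈ I),
        D (blowupAlgebra.gen I a x hx) = blowupAlgebra.gen I a (δ x) (hI x hx) := by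
  set L := Localization.Away a
  obtain ⟨δ', hδ'⟩ := exists_derivation_extend_of_isLocalization k L (Submonoid.powers a) δ
  -- `δ̃(x/a) = δ(x)/a`
  have hgen : ∀ x : R, δ' (algebraMap R L x * Away.invSelf a) =
      algebraMap R L (δ x) * Away.invSelf a := by
    intro x
    have h := congrArg δ' (div_mul_algebraMap a x)
    rw [Derivation.leibniz, hδ', hδ', ha, map_zero, smul_zero, zero_add, smul_eq_mul] at h
    -- `h : a · δ̃(x/a) = δ x`; multiply by `1/a`
    have h2 : algebraMap R L a * δ' (algebraMap R L x * Away.invSelf a) * Away.invSelf a =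
        algebraMap R L (δ x) * Away.invSelf a := by rw [h]
    rw [← h2, mul_comm (algebraMap R L a), mul_assoc, Away.mul_invSelf, mul_one]
  have hmem : ∀ y ∈ blowupAlgebra I a, δ' y ∈ blowupAlgebra I a := by
    intro y hy
    induction hy using Algebra.adjoin_induction with
    | mem y hy =>
      obtain ⟨x, hx, rfl⟩ := hy
      rw [hgen x]
      exact div_mem_blowupAlgebra I a (hI x hx)
    | algebraMap r =>
      rw [hδ']
      exact Subalgebra.algebraMap_mem _ _
    | add y z _ _ hy hz =>
      rw [map_add]
      exact Subalgebra.add_mem _ hy hz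
    | mul y z hy' hz' hy hz =>
      rw [Derivation.leibniz, smul_eq_mul, smul_eq_mul]
      exact Subalgebra.add_mem _ (Subalgebra.mul_mem _ hy' hz) (Subalgebra.mul_mem _ hz' hy)
  -- the restriction of `δ'` to `R[I/a]`
  let Dlin : blowupAlgebra I a →ₗ[k] blowupAlgebra I a :=
    { toFun := fun y => ⟨δ' y, hmem y y.2⟩
      map_add' := fun y z => Subtype.ext (by simp)
      map_smul' := fun c y => Subtype.ext (by simp) }
  refine ⟨⟨Dlin, Subtype.ext ?_, fun y z => Subtype.ext ?_⟩, fun r => Subtype.ext ?_,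
    fun x hx => Subtype.ext ?_⟩
  · change δ' 1 = 0
    exact δ'.map_one_eq_zero
  · change δ' (y * z) = (y • (⟨δ' z, hmem z z.2⟩ : blowupAlgebra I a) +
      z • (⟨δ' y, hmem y y.2⟩ : blowupAlgebra I a) : blowupAlgebra I a).val
    rw [Derivation.leibniz]
    rfl
  · change δ' (algebraMap R L r) = algebraMap R L (δ r)
    rw [hδ']
  · change δ' (algebraMap R L x * Away.invSelf a) = algebraMap R L (δ x) * Away.invSelf a
    exact hgen x

end Literature.AlgebraicGeometry.Resolution

end
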